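import Summits.KontsevichZagierPeriods.Zeta5Search.TwoTaleP15LineBoundRate
import Summits.KontsevichZagierPeriods.Zeta5Search.TwoTaleRungALineBoundRate
import Summits.KontsevichZagierPeriods.Zeta5Search.TwoTaleLineBoundRC
import Summits.KontsevichZagierPeriods.Zeta5Search.Denom.TwoTaleD1Forms

/-!
# RUNG D1 = L(1/3) `(19,16,13,22 | 0,3,6,38)`: the scaled line bound `log ‖Rₙ‖ ≤ n·rateD1(η) + O(log n + log(484+η²))` on `x = ⌊15n/2⌋ + ½`

HONEST FRAMING: systematic search; no irrationality claim unless certified.  Cell pub-zeta5 (P1 g12, file T3 of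
fam-denom's `families/denom/D1-DESIGN-NOTE.md`), T3 service.  No measure or irrationality claim: this is the D1 clone
of `TwoTaleRungALineRate` / `TwoTaleP15LineBoundRate` — the real-variable upper bound for the modulus of Zudilin's
rational function `Rₙ(s) = Zudilin2014.RC (aD1 n) (bD1 n) s` ([Zudilin2014ZetaTwo, §3] at the cone point
`a = (19n+1, 16n+1, 13n+1, 22n+1)`, `b = (1, 3n+1, 6n+1, 38n+2)`, `a₂* = 16n+1`) on the vertical line
`Re s = uₙ = xₙ + ½ − a₂*`, `xₙ = ⌊15n/2⌋` (the design abscissa `ξ = 15/2`: the tale-1 saddle is at `ξ* = 7.5010`,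
`η* = 3.0786`, value `−42.33438300`; at `ξ = 15/2` the supremum is `−42.3343826`, a loss of `4·10⁻⁷` nats —
`HOME/code/p1/g12/tale1_profile.py`), written at height `Im s = nη`:
* `rateD1 η = Σ± prim η Vᵢ* + 23 + κ_D1`, `V* = (21/2, −17/2 | 15/2, −11/2 | 9/2, −5/2 ‖ 59/2, 27/2)`,
  `κ_D1 = 16 log 16 − 19 log 19 − 13 log 13 − 7 log 7`, `prim η V = V·½log(V²+η²) − V + η·arctan(V/η)`
  (P1's `TwoTaleLineBound.prim`);
* **`log_norm_RCD1_line_le`**: for `n ≥ 3`, `η ≠ 0`,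
  `log ‖RC (aD1 n) (bD1 n) (uₙ + i·nη)‖ ≤ n·rateD1 η + 2·log n + 9·log(484 + η²) + K0D1`,
  `K0D1 = 12|log 2| + 3(1+log 2) + 1 + 9 log 2` (the endpoint constants come with `log(31² + η²)`, which is
  absorbed by `log(31² + η²) ≤ log 2 + log(22² + η²)` so that the `dy`-assembly of `TwoTaleP15LineBoundDecay`
  (majorant `(484+y²)⁹e^{−δ|y|}`) applies verbatim).
Ingredients (all tree): P1's GENERAL block bound `log_norm_RC_le`, `prim_scale`/`halfLog_scale`, the general endpoint
lemmas `prim_endpoint_gen` (`m = 2`, `M = 31`: the shortest leg `|V*| = 5/2` forces `n ≥ 3`) and `halfLog_endpoint_gen`,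
`log_factorial_two_sided` (the `n log n` terms: `+23 n log n` from the blocks against `−23 n log n` from
`Π = (16n)!/((19n)!(13n)!(7n)!)`).
What remains for `DecayD1 c`: the certificate `∀ η ≠ 0, rateD1 η − (2π−δ)|η| ≤ M` (`TwoTaleD1LineProfileShape`,
`TwoTaleD1LineCertificate`; numerically `sup = −42.3343826` at `η = ±3.0788`) and the `dy`-assembly (`TwoTaleD1Decay`).
-/

noncomputable section

open Real Complex
open Literature.NumberTheory.Irrationality.Zudilin2014
open Summit.KontsevichZagierPeriods.Zeta5Search.Denom.TwoTaleD1Forms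
open Summit.KontsevichZagierPeriods.Zeta5Search.TwoTaleLineBound

namespace Summit.KontsevichZagierPeriods.Zeta5Search.TwoTaleD1Line

/-- The abscissa `xₙ = ⌊15n/2⌋` (design line `ξ = 15/2`, loss `4·10⁻⁷` nats against the saddle `ξ* = 7.5010`). -/
def xLineD1 (n : ℕ) : ℕ := 15 * n / 2

/-- `uₙ = xₙ + ½ − (16n+1)`, the real part of the argument of `Rₙ` on the line. -/
def uLineD1 (n : ℕ) : ℝ := (xLineD1 n : ℝ) + 1 / 2 - (16 * n + 1)

/-- The entropy row `κ_D1 = 16 log 16 − 19 log 19 − 13 log 13 − 7 log 7` of `Π = (16n)!/((19n)!(13n)!(7n)!)`. -/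
def kappaD1 : ℝ := 16 * Real.log 16 - 19 * Real.log 19 - 13 * Real.log 13 - 7 * Real.log 7

/-- **The D1 rate function** `rateD1 η = Σ± prim η Vᵢ* + 23 + κ_D1`. -/
def rateD1 (η : ℝ) : ℝ :=
  (prim η (21 / 2) - prim η (-17 / 2)) + (prim η (15 / 2) - prim η (-11 / 2)) + (prim η (9 / 2) - prim η (-5 / 2))
    - (prim η (59 / 2) - prim η (27 / 2)) + 23 + kappaD1

/-- The Lipschitz constant of `prim η ·` on `2 ≤ |W| ≤ 31`. -/
def lipKD1 (η : ℝ) : ℝ := |Real.log 2| + Real.log (31 ^ 2 + η ^ 2) / 2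

/-- The constant `K0D1 = 12|log 2| + 3(1 + log 2) + 1 + 9 log 2` of the line bound. -/
def K0D1 : ℝ := 12 * |Real.log 2| + 3 * (1 + Real.log 2) + 1 + 9 * Real.log 2

/-- `xₙ ≤ 13n` (the line lies in the strip-shift range of `TwoTaleD1StripShift`). -/
theorem xLineD1_le (n : ℕ) : xLineD1 n ≤ 13 * n := by
  unfold xLineD1
  omega

/-- Floor bookkeeping: `−3/2 ≤ uₙ + 17n/2 ≤ −1/2`. -/
theorem uLineD1_bounds (n : ℕ) : -3 / 2 ≤ uLineD1 n + 17 * n / 2 ∧ uLineD1 n + 17 * n / 2 ≤ -1 / 2 := by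
  unfold uLineD1 xLineD1
  have h1 : 2 * (15 * n / 2) ≤ 15 * n := Nat.mul_div_le _ _
  have h2 : 15 * n < 2 * (15 * n / 2) + 2 := by omega
  have h1' : (2 : ℝ) * ((15 * n / 2 : ℕ) : ℝ) ≤ 15 * n := by exact_mod_cast h1
  have h2' : (15 : ℝ) * n < 2 * ((15 * n / 2 : ℕ) : ℝ) + 2 := by exact_mod_cast h2
  constructor <;> linarith

variable {η : ℝ}

/-- `lipKD1 η ≥ 0`. -/
theorem lipKD1_nonneg (η : ℝ) : 0 ≤ lipKD1 η := by
  unfold lipKD1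
  have : 0 ≤ Real.log (31 ^ 2 + η ^ 2) := Real.log_nonneg (by nlinarith [sq_nonneg η])
  positivity

/-- **Endpoint transfer at D1**: an endpoint `E` with `|E − nV*| ≤ 3/2`, `5/2 ≤ |V*| ≤ 59/2`, satisfies
`|prim (nη) E − (n·prim η V* + E·log n)| ≤ (3/2)·lipKD1 η` (`n ≥ 3`, `η ≠ 0`: the general lemma
`prim_endpoint_gen` with `m = 2`, `M = 31`). -/
theorem prim_endpointD1 (hη : η ≠ 0) {n : ℕ} (hn : 3 ≤ n) {E Vs : ℝ} (hE : |E - n * Vs| ≤ 3 / 2)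
    (hV1 : 5 / 2 ≤ |Vs|) (hV2 : |Vs| ≤ 59 / 2) :
    |prim (n * η) E - (n * prim η Vs + E * Real.log n)| ≤ 3 / 2 * lipKD1 η := by
  have hn1 : 1 ≤ n := by omega
  have hn3 : (3 : ℝ) ≤ n := by exact_mod_cast hn
  have hn0 : (0 : ℝ) < n := by linarith
  have hlow : (2 : ℝ) + 3 / (2 * n) ≤ |Vs| := by
    have : (3 : ℝ) / (2 * n) ≤ 1 / 2 := by
      rw [div_le_iff₀ (by positivity)]; linarith
    linarith
  have h := prim_endpoint_gen hη hn1 (m := 2) (M := 31) (by norm_num) (by norm_num) hE hlow (by linarith)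
  unfold lipKD1
  exact h

/-- A numerator endpoint halfLog term at D1: `|E| ≤ 31n` gives `halfLog (nη) E ≤ log n + lipKD1 η − |log 2|`. -/
theorem halfLog_endpointD1 (hη : η ≠ 0) {n : ℕ} (hn : 1 ≤ n) {E : ℝ} (hE : |E| ≤ 31 * n) :
    halfLog (n * η) E ≤ Real.log n + Real.log (31 ^ 2 + η ^ 2) / 2 :=
  halfLog_endpoint_gen hη hn (by norm_num) hE

/-! ### Stirling for `Π = (16n)!/((19n)!(13n)!(7n)!)` -/

/-- `Π` at D1 as factorials: `Pi (aD1 n) (bD1 n) = (16n)!/((19n)!(13n)!(7n)!)`. -/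
theorem PiD1_eq (n : ℕ) : Pi (aD1 n) (bD1 n) =
    ((16 * n).factorial : ℚ) / (((19 * n).factorial : ℚ) * ((13 * n).factorial : ℚ) * ((7 * n).factorial : ℚ)) := by
  have e3 : (bD1 n 3 - aD1 n 3 - 1).toNat = 16 * n := by rw [aD1_three, bD1_three]; omega
  have e0 : (aD1 n 0 - bD1 n 0).toNat = 19 * n := by rw [aD1_zero, bD1_zero]; omega
  have e1 : (aD1 n 1 - bD1 n 1).toNat = 13 * n := by rw [aD1_one, bD1_one]; omega
  have e2 : (aD1 n 2 - bD1 n 2).toNat = 7 * n := by rw [aD1_two, bD1_two]; omega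
  unfold Pi numFac facZ
  rw [e0, e1, e2, e3]

/-- `log |Π| = log (16n)! − log (19n)! − log (13n)! − log (7n)!`. -/
theorem log_abs_PiD1 (n : ℕ) : Real.log |((Pi (aD1 n) (bD1 n) : ℚ) : ℝ)| =
    Real.log ((16 * n).factorial : ℝ) - Real.log ((19 * n).factorial : ℝ) - Real.log ((13 * n).factorial : ℝ)
      - Real.log ((7 * n).factorial : ℝ) := by
  rw [PiD1_eq]
  push_cast
  have h : ∀ k : ℕ, (0 : ℝ) < (k.factorial : ℝ) := fun k => by exact_mod_cast Nat.factorial_pos k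
  rw [abs_of_pos (div_pos (h _) (mul_pos (mul_pos (h _) (h _)) (h _))),
    Real.log_div (h _).ne' (mul_pos (mul_pos (h _) (h _)) (h _)).ne',
    Real.log_mul (mul_pos (h _) (h _)).ne' (h _).ne', Real.log_mul (h _).ne' (h _).ne']
  ring

/-- **Stirling for `log |Π|`**: `log |Π| ≤ −23·n log n + n·κ_D1 + 23n − log n + 1` (`n ≥ 1`). -/
theorem log_abs_PiD1_le {n : ℕ} (hn : 1 ≤ n) :
    Real.log |((Pi (aD1 n) (bD1 n) : ℚ) : ℝ)| ≤ -23 * (n * Real.log n) + n * kappaD1 + 23 * n - Real.log n + 1 := by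
  have hn0 : (0 : ℝ) < n := by exact_mod_cast hn
  rw [log_abs_PiD1]
  have c16 : Real.log ((16 * n : ℕ) : ℝ) = Real.log 16 + Real.log n := by
    push_cast; exact Real.log_mul (by norm_num) hn0.ne'
  have c19 : Real.log ((19 * n : ℕ) : ℝ) = Real.log 19 + Real.log n := by
    push_cast; exact Real.log_mul (by norm_num) hn0.ne'
  have c13 : Real.log ((13 * n : ℕ) : ℝ) = Real.log 13 + Real.log n := by
    push_cast; exact Real.log_mul (by norm_num) hn0.ne'
  have c7 : Real.log ((7 * n : ℕ) : ℝ) = Real.log 7 + Real.log n := by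
    push_cast; exact Real.log_mul (by norm_num) hn0.ne'
  have s16 := (log_factorial_two_sided (n := 16 * n) (by omega)).2
  have s19 := (log_factorial_two_sided (n := 19 * n) (by omega)).1
  have s13 := (log_factorial_two_sided (n := 13 * n) (by omega)).1
  have s7 := (log_factorial_two_sided (n := 7 * n) (by omega)).1
  rw [c16] at s16; rw [c19] at s19; rw [c13] at s13; rw [c7] at s7
  simp only [Nat.cast_mul, Nat.cast_ofNat] at s16 s19 s13 s7
  have q16 : (16 * (n : ℝ)) * (Real.log 16 + Real.log n) = 16 * (n * Real.log 16) + 16 * (n * Real.log n) := by ring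
  have q19 : (19 * (n : ℝ)) * (Real.log 19 + Real.log n) = 19 * (n * Real.log 19) + 19 * (n * Real.log n) := by ring
  have q13 : (13 * (n : ℝ)) * (Real.log 13 + Real.log n) = 13 * (n * Real.log 13) + 13 * (n * Real.log n) := by ring
  have q7 : (7 * (n : ℝ)) * (Real.log 7 + Real.log n) = 7 * (n * Real.log 7) + 7 * (n * Real.log n) := by ring
  have hκ : (n : ℝ) * kappaD1 =
      16 * (n * Real.log 16) - 19 * (n * Real.log 19) - 13 * (n * Real.log 13) - 7 * (n * Real.log 7) := by
    unfold kappaD1; ring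
  have hlog1619 : Real.log 16 ≤ Real.log 19 := Real.log_le_log (by norm_num) (by norm_num)
  have hlog13 : 0 ≤ Real.log 13 := Real.log_nonneg (by norm_num)
  have hlog7 : 0 ≤ Real.log 7 := Real.log_nonneg (by norm_num)
  rw [hκ]
  linarith

/-! ### The line bound -/

set_option maxHeartbeats 400000 in
/-- **The scaled line bound at D1**: for `n ≥ 3`, `η ≠ 0`,
`log ‖RC (aD1 n) (bD1 n) (uₙ + i·nη)‖ ≤ n·rateD1 η + 2 log n + 9 log(22² + η²) + K0D1`. -/
theorem log_norm_RCD1_line_le (hη : η ≠ 0) {n : ℕ} (hn : 3 ≤ n) :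
    Real.log ‖RC (aD1 n) (bD1 n) ((uLineD1 n : ℂ) + (((n : ℝ) * η : ℝ) : ℂ) * I)‖ ≤
      n * rateD1 η + 2 * Real.log n + 9 * Real.log (22 ^ 2 + η ^ 2) + K0D1 := by
  have hnN : 1 ≤ n := by omega
  have hn0 : (0 : ℝ) < n := by exact_mod_cast (show 0 < n by omega)
  have hn1 : (1 : ℝ) ≤ n := by exact_mod_cast hnN
  have hy : (n : ℝ) * η ≠ 0 := mul_ne_zero hn0.ne' hη
  obtain ⟨hu1, hu2⟩ := uLineD1_bounds n
  set u : ℝ := uLineD1 n with hu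
  -- the general block bound, instantiated at D1
  have hlen : ∀ j : Fin 4, j ≠ 3 → bD1 n j + 2 ≤ aD1 n j := by
    intro j hj
    fin_cases j <;> simp at hj ⊢ <;> omega
  have hden : aD1 n 3 < bD1 n 3 := by rw [aD1_three, bD1_three]; omega
  have c3a : ((aD1 n 3 : ℤ) : ℝ) = 22 * n + 1 := by rw [aD1_three]; push_cast; ring
  have hu' : 1 ≤ u + ((aD1 n 3 : ℤ) : ℝ) := by rw [c3a]; linarith
  have hB := log_norm_RC_le hy hlen hden hu'
  have c0 : ((aD1 n 0 - 1 : ℤ) : ℝ) = 19 * n := by rw [aD1_zero]; push_cast; ring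
  have c0b : ((bD1 n 0 : ℤ) : ℝ) = 1 := by simp
  have c1 : ((aD1 n 1 - 1 : ℤ) : ℝ) = 16 * n := by rw [aD1_one]; push_cast; ring
  have c1b : ((bD1 n 1 : ℤ) : ℝ) = 3 * n + 1 := by rw [bD1_one]; push_cast; ring
  have c2 : ((aD1 n 2 - 1 : ℤ) : ℝ) = 13 * n := by rw [aD1_two]; push_cast; ring
  have c2b : ((bD1 n 2 : ℤ) : ℝ) = 6 * n + 1 := by rw [bD1_two]; push_cast; ring
  have c3 : ((bD1 n 3 - 1 : ℤ) : ℝ) = 38 * n + 1 := by rw [bD1_three]; push_cast; ring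
  rw [c0, c0b, c1, c1b, c2, c2b, c3, c3a] at hB
  -- the eight endpoints
  have a1 : (5:ℝ) / 2 ≤ |(21:ℝ) / 2| ∧ |(21:ℝ) / 2| ≤ 59 / 2 := by rw [abs_of_pos (by norm_num)]; norm_num
  have a2 : (5:ℝ) / 2 ≤ |(-17:ℝ) / 2| ∧ |(-17:ℝ) / 2| ≤ 59 / 2 := by rw [abs_of_neg (by norm_num)]; norm_num
  have a3 : (5:ℝ) / 2 ≤ |(15:ℝ) / 2| ∧ |(15:ℝ) / 2| ≤ 59 / 2 := by rw [abs_of_pos (by norm_num)]; norm_num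
  have a4 : (5:ℝ) / 2 ≤ |(-11:ℝ) / 2| ∧ |(-11:ℝ) / 2| ≤ 59 / 2 := by rw [abs_of_neg (by norm_num)]; norm_num
  have a5 : (5:ℝ) / 2 ≤ |(9:ℝ) / 2| ∧ |(9:ℝ) / 2| ≤ 59 / 2 := by rw [abs_of_pos (by norm_num)]; norm_num
  have a6 : (5:ℝ) / 2 ≤ |(-5:ℝ) / 2| ∧ |(-5:ℝ) / 2| ≤ 59 / 2 := by rw [abs_of_neg (by norm_num)]; norm_num
  have a7 : (5:ℝ) / 2 ≤ |(59:ℝ) / 2| ∧ |(59:ℝ) / 2| ≤ 59 / 2 := by rw [abs_of_pos (by norm_num)]; norm_num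
  have a8 : (5:ℝ) / 2 ≤ |(27:ℝ) / 2| ∧ |(27:ℝ) / 2| ≤ 59 / 2 := by rw [abs_of_pos (by norm_num)]; norm_num
  obtain ⟨e1a, e1b⟩ := abs_le.1 (prim_endpointD1 hη hn (E := u + 19 * n) (Vs := 21 / 2)
    (by rw [abs_le]; constructor <;> linarith) a1.1 a1.2)
  obtain ⟨e2a, e2b⟩ := abs_le.1 (prim_endpointD1 hη hn (E := u + 1) (Vs := -17 / 2)
    (by rw [abs_le]; constructor <;> linarith) a2.1 a2.2)
  obtain ⟨e3a, e3b⟩ := abs_le.1 (prim_endpointD1 hη hn (E := u + 16 * n) (Vs := 15 / 2)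
    (by rw [abs_le]; constructor <;> linarith) a3.1 a3.2)
  obtain ⟨e4a, e4b⟩ := abs_le.1 (prim_endpointD1 hη hn (E := u + (3 * n + 1)) (Vs := -11 / 2)
    (by rw [abs_le]; constructor <;> linarith) a4.1 a4.2)
  obtain ⟨e5a, e5b⟩ := abs_le.1 (prim_endpointD1 hη hn (E := u + 13 * n) (Vs := 9 / 2)
    (by rw [abs_le]; constructor <;> linarith) a5.1 a5.2)
  obtain ⟨e6a, e6b⟩ := abs_le.1 (prim_endpointD1 hη hn (E := u + (6 * n + 1)) (Vs := -5 / 2)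
    (by rw [abs_le]; constructor <;> linarith) a6.1 a6.2)
  obtain ⟨e7a, e7b⟩ := abs_le.1 (prim_endpointD1 hη hn (E := u + (38 * n + 1)) (Vs := 59 / 2)
    (by rw [abs_le]; constructor <;> linarith) a7.1 a7.2)
  obtain ⟨e8a, e8b⟩ := abs_le.1 (prim_endpointD1 hη hn (E := u + (22 * n + 1) - 1) (Vs := 27 / 2)
    (by rw [abs_le]; constructor <;> linarith) a8.1 a8.2)
  -- the six endpoint halfLog terms
  have l1 := halfLog_endpointD1 hη hnN (E := u + 1) (by rw [abs_le]; constructor <;> linarith)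
  have l2 := halfLog_endpointD1 hη hnN (E := u + 19 * n) (by rw [abs_le]; constructor <;> linarith)
  have l3 := halfLog_endpointD1 hη hnN (E := u + (3 * n + 1)) (by rw [abs_le]; constructor <;> linarith)
  have l4 := halfLog_endpointD1 hη hnN (E := u + 16 * n) (by rw [abs_le]; constructor <;> linarith)
  have l5 := halfLog_endpointD1 hη hnN (E := u + (6 * n + 1)) (by rw [abs_le]; constructor <;> linarith)
  have l6 := halfLog_endpointD1 hη hnN (E := u + 13 * n) (by rw [abs_le]; constructor <;> linarith)
  -- Stirling
  have hP := log_abs_PiD1_le hnN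
  have hlogn : 0 ≤ Real.log n := Real.log_nonneg hn1
  -- `log (31² + η²) ≤ log 2 + log (22² + η²)` (absorbs the wider Lipschitz range into the P15 majorant)
  have hlog31 : Real.log (31 ^ 2 + η ^ 2) ≤ Real.log 2 + Real.log (22 ^ 2 + η ^ 2) := by
    have hη2 : 0 ≤ η ^ 2 := sq_nonneg η
    have h' : (31 : ℝ) ^ 2 + η ^ 2 ≤ 2 * (22 ^ 2 + η ^ 2) := by norm_num; linarith
    rw [← Real.log_mul (by norm_num) (by positivity)]
    exact Real.log_le_log (by positivity) h'
  -- linearise the products (each product is an atom for `linarith`)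
  have p1 : (u + 19 * n) * Real.log n = u * Real.log n + 19 * (n * Real.log n) := by ring
  have p2 : (u + 1) * Real.log n = u * Real.log n + Real.log n := by ring
  have p3 : (u + 16 * n) * Real.log n = u * Real.log n + 16 * (n * Real.log n) := by ring
  have p4 : (u + (3 * n + 1)) * Real.log n = u * Real.log n + 3 * (n * Real.log n) + Real.log n := by ring
  have p5 : (u + 13 * n) * Real.log n = u * Real.log n + 13 * (n * Real.log n) := by ring
  have p6 : (u + (6 * n + 1)) * Real.log n = u * Real.log n + 6 * (n * Real.log n) + Real.log n := by ring
  have p7 : (u + (38 * n + 1)) * Real.log n = u * Real.log n + 38 * (n * Real.log n) + Real.log n := by ring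
  have p8 : (u + (22 * n + 1) - 1) * Real.log n = u * Real.log n + 22 * (n * Real.log n) := by ring
  have hG : (n : ℝ) * rateD1 η = n * prim η (21 / 2) - n * prim η (-17 / 2) + (n * prim η (15 / 2) - n * prim η (-11 / 2))
      + (n * prim η (9 / 2) - n * prim η (-5 / 2)) - (n * prim η (59 / 2) - n * prim η (27 / 2)) + 23 * n
      + n * kappaD1 := by
    unfold rateD1; ring
  have hKdef : lipKD1 η = |Real.log 2| + Real.log (31 ^ 2 + η ^ 2) / 2 := rfl
  have hK0 : K0D1 = 12 * |Real.log 2| + 3 * (1 + Real.log 2) + 1 + 9 * Real.log 2 := rfl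
  rw [hG, hK0]
  rw [p1] at e1b; rw [p2] at e2a; rw [p3] at e3b; rw [p4] at e4a; rw [p5] at e5b; rw [p6] at e6a
  rw [p7] at e7a; rw [p8] at e8b
  rw [hKdef] at e1b e2a e3b e4a e5b e6a e7a e8b
  clear e1a e2b e3a e4b e5a e6b e7b e8a p1 p2 p3 p4 p5 p6 p7 p8 a1 a2 a3 a4 a5 a6 a7 a8
  -- assemble in linear steps (keeps each `linarith` small); the final `set`s name the atoms so that
  -- `linarith` sees syntactically identical terms on both sides
  have step1 : prim (n * η) (u + 19 * n) - prim (n * η) (u + 1)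
      + (prim (n * η) (u + 16 * n) - prim (n * η) (u + (3 * n + 1)))
      + (prim (n * η) (u + 13 * n) - prim (n * η) (u + (6 * n + 1)))
      - (prim (n * η) (u + (38 * n + 1)) - prim (n * η) (u + (22 * n + 1) - 1)) ≤
      (n * prim η (21 / 2) - n * prim η (-17 / 2) + (n * prim η (15 / 2) - n * prim η (-11 / 2))
        + (n * prim η (9 / 2) - n * prim η (-5 / 2)) - (n * prim η (59 / 2) - n * prim η (27 / 2)))
      + 23 * (n * Real.log n) - 4 * Real.log n + 12 * (|Real.log 2| + Real.log (31 ^ 2 + η ^ 2) / 2) := by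
    linarith [e1b, e2a, e3b, e4a, e5b, e6a, e7a, e8b]
  have step2 := add_le_add (add_le_add (add_le_add (add_le_add (add_le_add l1 l2) l3) l4) l5) l6
  have hfin : Real.log ‖RC (aD1 n) (bD1 n) ((u : ℂ) + (((n : ℝ) * η : ℝ) : ℂ) * I)‖ ≤
      (n * prim η (21 / 2) - n * prim η (-17 / 2) + (n * prim η (15 / 2) - n * prim η (-11 / 2))
        + (n * prim η (9 / 2) - n * prim η (-5 / 2)) - (n * prim η (59 / 2) - n * prim η (27 / 2)))
      + n * kappaD1 + 23 * n + Real.log n + 12 * |Real.log 2| + 3 * (1 + Real.log 2) + 1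
      + 9 * Real.log (31 ^ 2 + η ^ 2) := by
    linarith [hB, step1, step2, hP]
  set L22 := Real.log (22 ^ 2 + η ^ 2) with hL22
  set L31 := Real.log (31 ^ 2 + η ^ 2) with hL31
  set LN := Real.log (n : ℝ) with hLN
  set LR := Real.log ‖RC (aD1 n) (bD1 n) ((u : ℂ) + (((n : ℝ) * η : ℝ) : ℂ) * I)‖ with hLR
  set S := (n * prim η (21 / 2) - n * prim η (-17 / 2) + (n * prim η (15 / 2) - n * prim η (-11 / 2))
        + (n * prim η (9 / 2) - n * prim η (-5 / 2)) - (n * prim η (59 / 2) - n * prim η (27 / 2))) with hS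
  set NK := (n : ℝ) * kappaD1 with hNK
  set L2 := Real.log 2 with hL2
  linarith only [hfin, hlogn, hlog31, abs_nonneg L2]

end Summit.KontsevichZagierPeriods.Zeta5Search.TwoTaleD1Line

end
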